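import Literature.NumberTheory.Rogawski1990.UnitStableOrbitalIntegralHSideValue           -- ★ p840855 (L5) FINAL: `natCard_fixedBy_eq_ncard_selfDualStable_antidiagTwo`, instance block pattern
import Literature.NumberTheory.Automorphic.PlaneLatticesCompanionSelfDualCount            -- ★ p841356 (β2′-ii): `ncard_selfDualStable_antidiag_companion_eq_sum`
import Literature.NumberTheory.Rogawski1990.FinExplicitTransferFactorInertExponentStub    -- ★ A-p13: `valued_trace_le_one_and_valued_det_le_one_of_hint`
import Literature.NumberTheory.Rogawski1990.UnitOrbitalIntegralInertClosedFormsTypeTwo    -- ★ B-p14: `Flicker1998.phiHtwo`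
import Literature.NumberTheory.Automorphic.SelfDualLatticeCountFrameTransport            -- ★ p840701 (L5-d1) FILE A: `ncard_selfDualStable_congr` (any frame)
import HarnessLib

/-!
# The TYPE-(2) H-side value of the inert unit fundamental lemma: `Φ(⟦γ_H⟧, 1_{K_H}) = phiHtwo q N = (q^{N+1} − 1)∕(q − 1)` (Flicker 1998, p. 97)

Topic `NumberTheory/Rogawski1990`; namespace `Literature.NumberTheory.Automorphic.UnitaryGroup`.  THEOREMS ONLY (no definition, no instance, no notation, no named
fact, no `sorry`).  Cell `pub/hodgecm-mathlib`, F0∕P3a road «D-N7-inert» ∕ MAP v3 (F11-d): the payer of the value stub `stub_irredHValue (N hN)` of the line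
«N7nsCount» ED. 1.3 (architect A-p06 (g26); LEAD F0P3a-plan (g9) T8-65∕T8-72), modulo ONE named binder: the compactness of the centraliser of the type-(2) element
(`[CompactSpace Z(γ₂)]`, the anisotropic torus `(EL)¹` — no eigenframe over `E_v`, so ★ (E4) does not apply; to be discharged by a norm-form bound).  HC_CM is proved only
modulo the printed citations until rung 0 closes; every other input is ★: PAIR socket p840404, lattice socket, ★ (L5-d1) FILE A frame transport (A-p13, any frame), the
ISOTROPIC CYCLIC FRAME (§1 here), the normalised count ★ (β2′) p841314∕p841356 over ★ (β1) p841196 ∕ ★ (β3′) p841260, the exponent data ★ A-p13 p841303-style (`hint` ⇒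
`tr, det ∈ 𝒪`), and `phiHtwo` ★ B-p14.

THE FRAME (§1, any field `K`, `σ : K →+* K`).  For `g ∈ M₂(K)` with `g₁₀ ≠ 0` put `P := !![1, g₀₀; 0, g₁₀]` (columns `e₀, g e₀`).  Then `g P = P C`, `C = !![0, −det g; 1, tr g]`
(Cayley–Hamilton), and for the hyperbolic form `Φ₂ = !![0, 1; 1, 0]`: `ᵗ(σP) Φ₂ P = !![0, g₁₀; σ g₁₀, σg₀₀ g₁₀ + σg₁₀ g₀₀]`, whose corner vanishes when `g ∈ U(Φ₂)`
(`e₀` and `g e₀` are isotropic).  Unitarity of `C` for `!![0, β; σβ, 0]` (`β = g₁₀`) gives `d σβ = −β` and `β σt + σβ t = 0`.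

* §1 `mul_cyclicFrame_eq_cyclicFrame_mul_companion`, `formCongr_cyclicFrame_antidiagOne`, `corner_eq_zero_of_unitary_antidiagOne`, `companion_unitary_antidiag_relations`.
* §2 **`classOrbitalIntegral_indicator_eq_phiHtwo_of_not_exists_isRoot`** — the value, in the stub frame of `stub_irredHValue` plus `[CompactSpace Z(γH.1)]`.

## References
* [Flicker1998UnitaryFL] Y. Z. Flicker, *Elementary proof of the fundamental lemma for a unitary group*, Canad. J. Math. 50 (1998), §6 p. 95 REMARK, p. 97.
* [Rogawski1990] J. D. Rogawski, *Automorphic Representations of Unitary Groups in Three Variables* (1990), §4.9 Prop. 4.9.1 (b) p. 55; §3.6 p. 31.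
-/

set_option autoImplicit false

noncomputable section

open MeasureTheory NumberField IsDedekindDomain Matrix Finset ValuativeRel
open scoped ValuativeRel Matrix MatrixGroups

namespace Literature.NumberTheory.Automorphic.UnitaryGroup

open Literature.NumberTheory.Rogawski1990

/-! ## §1 The isotropic cyclic frame (any field) -/

section Frame

variable {K : Type*} [Field K] (σ : K →+* K)

/-- **Cayley–Hamilton in the cyclic frame**: `g · P = P · C(tr g, det g)` for `P = !![1, g₀₀; 0, g₁₀]` (columns `e₀`, `g e₀`). [cite: Rogawski1990, §3.6 p. 31] -/
theorem mul_cyclicFrame_eq_cyclicFrame_mul_companion (g : Matrix (Fin 2) (Fin 2) K) :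
    g * !![1, g 0 0; 0, g 1 0] = !![1, g 0 0; 0, g 1 0] * !![0, -g.det; 1, g.trace] := by
  rw [Matrix.det_fin_two, Matrix.trace_fin_two]
  ext i j
  fin_cases i <;> fin_cases j <;> simp [Matrix.mul_apply, Fin.sum_univ_two] <;> ring

/-- **The Gram matrix of `Φ₂ = !![0, 1; 1, 0]` in the cyclic frame**: `ᵗ(σP) Φ₂ P = !![0, g₁₀; σ g₁₀, σg₀₀ g₁₀ + σg₁₀ g₀₀]`. [cite: Rogawski1990, §3.6 p. 31] -/
theorem formCongr_cyclicFrame_antidiagOne (g : Matrix (Fin 2) (Fin 2) K) (P : GL (Fin 2) K) (hP : (P : Matrix (Fin 2) (Fin 2) K) = !![1, g 0 0; 0, g 1 0]) :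
    formCongr σ P (!![0, 1; 1, 0] : Matrix (Fin 2) (Fin 2) K) = !![0, g 1 0; σ (g 1 0), σ (g 0 0) * g 1 0 + σ (g 1 0) * g 0 0] := by
  rw [formCongr, hP]
  ext i j
  fin_cases i <;> fin_cases j <;> simp [Matrix.mul_apply, Fin.sum_univ_two, Matrix.transpose_apply, Matrix.map_apply]
  ring

/-- **`e₀` and `g e₀` are isotropic for a unitary `g`**: if `ᵗ(σg) Φ₂ g = Φ₂` then `σg₀₀ g₁₀ + σg₁₀ g₀₀ = 0`. [cite: Rogawski1990, §3.6 p. 31] -/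
theorem corner_eq_zero_of_unitary_antidiagOne (g : Matrix (Fin 2) (Fin 2) K)
    (hg : (g.map σ)ᵀ * (!![0, 1; 1, 0] : Matrix (Fin 2) (Fin 2) K) * g = !![0, 1; 1, 0]) : σ (g 0 0) * g 1 0 + σ (g 1 0) * g 0 0 = 0 := by
  have h := congrFun (congrFun hg 0) 0
  simp [Matrix.mul_apply, Fin.sum_univ_two, Matrix.transpose_apply, Matrix.map_apply] at h
  linear_combination h

/-- **Unitarity of the companion matrix for `!![0, β; σβ, 0]`** gives `d · σβ = −β` and `β σt + σβ t = 0` (so `|d| = 1` and `Tr(σβ · t) = 0`).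
[cite: Flicker1998UnitaryFL, §6 p. 97] [cite: Rogawski1990, §3.6 p. 31] -/
theorem companion_unitary_antidiag_relations {t d β : K} (C : GL (Fin 2) K) (hC : (C : Matrix (Fin 2) (Fin 2) K) = !![0, -d; 1, t])
    (hU : formCongr σ C (!![0, β; σ β, 0] : Matrix (Fin 2) (Fin 2) K) = !![0, β; σ β, 0]) :
    d * σ β = -β ∧ σ d * β = -σ β ∧ β * σ t + σ β * t = 0 := by
  rw [formCongr, hC] at hU
  have hmap : (!![0, -d; 1, t] : Matrix (Fin 2) (Fin 2) K).map σ = !![0, -σ d; 1, σ t] := by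
    ext i j; fin_cases i <;> fin_cases j <;> simp
  rw [hmap] at hU
  have h01 := congrFun (congrFun hU 0) 1
  have h10 := congrFun (congrFun hU 1) 0
  have h11 := congrFun (congrFun hU 1) 1
  simp [Matrix.mul_apply, Fin.sum_univ_two, Matrix.transpose_apply] at h01 h10 h11
  refine ⟨by linear_combination -h01, by linear_combination -h10, ?_⟩
  linear_combination h11 - (σ t) * h01 - t * h10


/-- **THE RESCALED ISOTROPIC CYCLIC FRAME** (any field): for `g ∈ GL₂(K)` unitary for `!![0, 1; 1, 0]` with `g₁₀ ≠ 0`, and a `σ`-fixed scalar `a ≠ 0`, the frame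
`P′ = !![1, g₀₀; 0, g₁₀] · diag(a, a)` has `P′⁻¹ g P′ = C(tr g, det g)` and Gram matrix `!![0, a² g₁₀; σ(a² g₁₀), 0]`; moreover `det g · σ g₁₀ = −g₁₀` and
`g₁₀ σ(tr g) + σ g₁₀ · tr g = 0`. [cite: Rogawski1990, §3.6 p. 31] [cite: Flicker1998UnitaryFL, §6 p. 97] -/
theorem exists_rescaled_cyclicFrame (gGL : GL (Fin 2) K) (g : Matrix (Fin 2) (Fin 2) K) (hcoe : (gGL : Matrix (Fin 2) (Fin 2) K) = g)
    (hgU : (g.map σ)ᵀ * (!![0, 1; 1, 0] : Matrix (Fin 2) (Fin 2) K) * g = !![0, 1; 1, 0]) (hg10 : g 1 0 ≠ 0)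
    {a : K} (ha0 : a ≠ 0) (hσa : σ a = a) :
    ∃ P' : GL (Fin 2) K, ((P'⁻¹ * gGL * P' : GL (Fin 2) K) : Matrix (Fin 2) (Fin 2) K) = !![0, -g.det; 1, g.trace] ∧
      formCongr σ P' (!![0, 1; 1, 0] : Matrix (Fin 2) (Fin 2) K) = !![0, a ^ 2 * g 1 0; σ (a ^ 2 * g 1 0), 0] ∧
      g.det * σ (g 1 0) = -g 1 0 ∧ g 1 0 * σ g.trace + σ (g 1 0) * g.trace = 0 := by
  -- the frame `P`
  have hdetP : (!![1, g 0 0; 0, g 1 0] : Matrix (Fin 2) (Fin 2) K).det ≠ 0 := by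
    rw [Matrix.det_fin_two_of]; simpa using hg10
  obtain ⟨P, hP⟩ : ∃ P : GL (Fin 2) K, (P : Matrix (Fin 2) (Fin 2) K) = !![1, g 0 0; 0, g 1 0] :=
    ⟨Matrix.GeneralLinearGroup.mk'' (!![1, g 0 0; 0, g 1 0]) (isUnit_iff_ne_zero.2 hdetP), rfl⟩
  have hgP : g * (P : Matrix (Fin 2) (Fin 2) K) = (P : Matrix (Fin 2) (Fin 2) K) * !![0, -g.det; 1, g.trace] := by
    rw [hP]; exact mul_cyclicFrame_eq_cyclicFrame_mul_companion g
  have hHP : formCongr σ P (!![0, 1; 1, 0] : Matrix (Fin 2) (Fin 2) K) = !![0, g 1 0; σ (g 1 0), 0] := by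
    rw [formCongr_cyclicFrame_antidiagOne σ g P hP, corner_eq_zero_of_unitary_antidiagOne σ g hgU]
  have hC : ((P⁻¹ * gGL * P : GL (Fin 2) K) : Matrix (Fin 2) (Fin 2) K) = !![0, -g.det; 1, g.trace] := by
    rw [Units.val_mul, Units.val_mul, hcoe, Matrix.mul_assoc, hgP, ← Matrix.mul_assoc, Units.inv_mul, Matrix.one_mul]
  -- unitarity of `C` for `H_P`, relations
  have hgform : formCongr σ gGL (!![0, 1; 1, 0] : Matrix (Fin 2) (Fin 2) K) = !![0, 1; 1, 0] := by rw [formCongr, hcoe]; exact hgU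
  have hPPi : formCongr σ P⁻¹ (formCongr σ P (!![0, 1; 1, 0] : Matrix (Fin 2) (Fin 2) K)) = !![0, 1; 1, 0] := by
    rw [← formCongr_mul σ (!![0, 1; 1, 0] : Matrix (Fin 2) (Fin 2) K) P P⁻¹, mul_inv_cancel]
    simp [formCongr, Matrix.map_one σ (map_zero _) (map_one _)]
  have hCU : formCongr σ (P⁻¹ * gGL * P) (!![0, g 1 0; σ (g 1 0), 0] : Matrix (Fin 2) (Fin 2) K) = !![0, g 1 0; σ (g 1 0), 0] := by
    rw [← hHP, mul_assoc, formCongr_mul σ _ P⁻¹ (gGL * P), hPPi, formCongr_mul σ _ gGL P, hgform]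
  obtain ⟨hdβ, -, htr⟩ := companion_unitary_antidiag_relations σ (P⁻¹ * gGL * P) hC hCU
  -- the rescaled frame `P' = P · diag(a, a)`
  have hdetD : (!![a, 0; 0, a] : Matrix (Fin 2) (Fin 2) K).det ≠ 0 := by rw [Matrix.det_fin_two_of]; simpa using mul_ne_zero ha0 ha0
  obtain ⟨D, hDval⟩ : ∃ D : GL (Fin 2) K, (D : Matrix (Fin 2) (Fin 2) K) = !![a, 0; 0, a] :=
    ⟨Matrix.GeneralLinearGroup.mk'' _ (isUnit_iff_ne_zero.2 hdetD), rfl⟩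
  refine ⟨P * D, ?_, ?_, hdβ, htr⟩
  · have hgrp : (P * D)⁻¹ * gGL * (P * D) = D⁻¹ * (P⁻¹ * gGL * P) * D := by group
    rw [hgrp, Units.val_mul, Units.val_mul, hC, Matrix.coe_units_inv, hDval, upperTriangular_inv ha0 ha0]
    have f11 : a⁻¹ * 0 + -(a⁻¹ * 0 * a⁻¹) * 1 = (0 : K) := by ring
    have f12 : a⁻¹ * -g.det + -(a⁻¹ * 0 * a⁻¹) * g.trace = -(a⁻¹ * g.det) := by ring
    have f21 : (0 : K) * 0 + a⁻¹ * 1 = a⁻¹ := by ring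
    have f22 : (0 : K) * -g.det + a⁻¹ * g.trace = a⁻¹ * g.trace := by ring
    have e11 : (0 : K) * a + -(a⁻¹ * g.det) * 0 = 0 := by ring
    have e12 : (0 : K) * 0 + -(a⁻¹ * g.det) * a = -g.det := by field_simp; ring
    have e21 : a⁻¹ * a + a⁻¹ * g.trace * 0 = (1 : K) := by rw [mul_zero, add_zero, inv_mul_cancel₀ ha0]
    have e22 : a⁻¹ * 0 + a⁻¹ * g.trace * a = g.trace := by field_simp; ring
    rw [Matrix.mul_fin_two, f11, f12, f21, f22, Matrix.mul_fin_two, e11, e12, e21, e22]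
  · rw [formCongr_mul, hHP, formCongr, hDval]
    have hmapT : ((!![a, 0; 0, a] : Matrix (Fin 2) (Fin 2) K).map σ)ᵀ = !![a, 0; 0, a] :=
      Matrix.ext fun i j => by fin_cases i <;> fin_cases j <;> simp [hσa]
    rw [hmapT]
    have f11 : (0 : K) * a + g 1 0 * 0 = 0 := by ring
    have f12 : (0 : K) * 0 + g 1 0 * a = g 1 0 * a := by ring
    have f21 : σ (g 1 0) * a + 0 * 0 = σ (g 1 0) * a := by ring
    have f22 : σ (g 1 0) * 0 + (0 : K) * a = 0 := by ring
    have e11 : a * 0 + 0 * (σ (g 1 0) * a) = (0 : K) := by ring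
    have e12 : a * (g 1 0 * a) + 0 * 0 = a ^ 2 * g 1 0 := by ring
    have e21 : 0 * 0 + a * (σ (g 1 0) * a) = σ (a ^ 2 * g 1 0) := by rw [map_mul, map_pow, hσa]; ring
    have e22 : 0 * (g 1 0 * a) + a * 0 = (0 : K) := by ring
    rw [Matrix.mul_assoc, Matrix.mul_fin_two, f11, f12, f21, f22, Matrix.mul_fin_two, e11, e12, e21, e22]

end Frame

/-! ## §2 The normalised type-(2) count at `w` -/

section AtPlace

variable (L : Type) [Field L] [NumberField L] [IsCMField L] (v : HeightOneSpectrum (𝓞 ↥(maximalRealSubfield L)))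
  (w : PlacesOver L v) (hw : IsCMField.complexConj L • w.1 = w.1)

include hw in
/-- **THE NORMALISED TYPE-(2) COUNT AT `w`** — ★ (β2′-ii) `ncard_selfDualStable_antidiag_companion_eq_sum` at `F := L_w`, `σ := σ_w`, `ϖ := ι_w(ϖ_v)`: for `t, d, β ∈ L_w` with
`|t| ≤ 1`, `|2| = 1`, `|β| = |ϖ^e|` (`e ≤ 1`), `|t² − 4d| = |ϖ^(2N+1)|`, `β σt + σβ t = 0`, and `↑γ = !![0, −d; 1, t]` with `|d| = 1`:
`#S(!![0, β; σβ, 0], γ) = Σ_(k ≤ N) q_v^k` (`|𝓀_w| = q_v²`, `σ_w` moves an integer by a unit — the inert instance block of ★ p840855).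
[cite: Flicker1998UnitaryFL, §6 p. 97] [cite: Serre1979, Ch. V §2] -/
theorem ncard_selfDualStable_antidiag_companion_eq_sum_at (hunr : Algebra.IsUnramifiedIn (𝓞 L) v.asIdeal)
    (h2 : valuation (w.1.adicCompletion L) 2 = 1) {t d β : (w.1.adicCompletion L)} (ht : t ∈ 𝒪[(w.1.adicCompletion L)]) (hd : valuation (w.1.adicCompletion L) d = 1)
    {e : ℕ} (he : e ≤ 1) (hβ : valuation (w.1.adicCompletion L) β = valuation (w.1.adicCompletion L) ((toPlace v w (GaloisRepresentations.HeckeCharacter.uniformizer ↥(maximalRealSubfield L) v : v.adicCompletion ↥(maximalRealSubfield L))) ^ e)) {N : ℕ}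
    (hD : valuation (w.1.adicCompletion L) (t ^ 2 - 4 * d) = valuation (w.1.adicCompletion L) ((toPlace v w (GaloisRepresentations.HeckeCharacter.uniformizer ↥(maximalRealSubfield L) v : v.adicCompletion ↥(maximalRealSubfield L))) ^ (2 * N + 1)))
    (htr : β * (galAdicCompletionMap (L := L) (IsCMField.complexConj L) hw) t + (galAdicCompletionMap (L := L) (IsCMField.complexConj L) hw) β * t = 0)
    (γ : GL (Fin 2) (w.1.adicCompletion L)) (hγ : (γ : Matrix (Fin 2) (Fin 2) (w.1.adicCompletion L)) = !![0, -d; 1, t]) :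
    {Λ : Submodule 𝒪[(w.1.adicCompletion L)] (Fin 2 → (w.1.adicCompletion L)) |
        (∃ g : GL (Fin 2) (w.1.adicCompletion L), (∃ J' ∈ glInt 2 (w.1.adicCompletion L), (J' : Matrix (Fin 2) (Fin 2) (w.1.adicCompletion L)) =
            formCongr (galAdicCompletionMap (L := L) (IsCMField.complexConj L) hw) g (!![0, β; (galAdicCompletionMap (L := L) (IsCMField.complexConj L) hw) β, 0] : Matrix (Fin 2) (Fin 2) (w.1.adicCompletion L))) ∧
          Λ = Submodule.span 𝒪[(w.1.adicCompletion L)] (Set.range ((g : Matrix (Fin 2) (Fin 2) (w.1.adicCompletion L)))ᵀ)) ∧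
        Λ.map ((Matrix.toLin' (γ : Matrix (Fin 2) (Fin 2) (w.1.adicCompletion L))).restrictScalars 𝒪[(w.1.adicCompletion L)]) = Λ}.ncard =
      ∑ k ∈ range (N + 1), Nat.card (𝓞 ↥(maximalRealSubfield L) ⧸ v.asIdeal) ^ k := by
  classical
  have hc1 : IsCMField.complexConj L ≠ 1 := IsCMField.complexConj_ne_one L
  have hϖv := Liu2021.LemD1IndexedNonVacuityInertCofinite.valued_toPlace_uniformizer_of_isUnramifiedIn L v hunr w
  have hϖ : IsUniformizingElement (toPlace v w (GaloisRepresentations.HeckeCharacter.uniformizer ↥(maximalRealSubfield L) v : v.adicCompletion ↥(maximalRealSubfield L))) := isUniformizingElement_of_v_eq hϖv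
  haveI : IsDiscreteValuationRing 𝒪[(w.1.adicCompletion L)] := isDiscreteValuationRing_integer_of_compatible hϖv
  have hσO : ∀ x : 𝒪[(w.1.adicCompletion L)], (galAdicCompletionMap (L := L) (IsCMField.complexConj L) hw) x ∈ 𝒪[(w.1.adicCompletion L)] := mem_integer_galAdicCompletionMap (IsCMField.complexConj L) v w hw
  let σO : 𝒪[(w.1.adicCompletion L)] →+* 𝒪[(w.1.adicCompletion L)] := ((galAdicCompletionMap (L := L) (IsCMField.complexConj L) hw).comp (𝒪[(w.1.adicCompletion L)]).subtype).codRestrict 𝒪[(w.1.adicCompletion L)] fun x => hσO x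
  have hσO' : ∀ x : 𝒪[(w.1.adicCompletion L)], ((σO x : 𝒪[(w.1.adicCompletion L)]) : (w.1.adicCompletion L)) = (galAdicCompletionMap (L := L) (IsCMField.complexConj L) hw) x := fun _ => rfl
  have hσσ : ∀ x, σO (σO x) = x := fun x =>
    Subtype.ext (galAdicCompletionMap_galAdicCompletionMap_of_smul_eq (IsCMField.complexConj L) w hc1 hw (x : (w.1.adicCompletion L)))
  have hσϖ : (galAdicCompletionMap (L := L) (IsCMField.complexConj L) hw) (toPlace v w (GaloisRepresentations.HeckeCharacter.uniformizer ↥(maximalRealSubfield L) v : v.adicCompletion ↥(maximalRealSubfield L))) = (toPlace v w (GaloisRepresentations.HeckeCharacter.uniformizer ↥(maximalRealSubfield L) v : v.adicCompletion ↥(maximalRealSubfield L))) := galAdicCompletionMap_toPlace (IsCMField.complexConj L) w w hw _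
  have hσv : ∀ x, valuation (w.1.adicCompletion L) ((galAdicCompletionMap (L := L) (IsCMField.complexConj L) hw) x) = valuation (w.1.adicCompletion L) x := fun x => valuation_galAdicCompletionMap_eq (IsCMField.complexConj L) v w hw x
  obtain ⟨σk, hσk⟩ := exists_residueField_ringHom_galAdicCompletionMap (IsCMField.complexConj L) v w hw
  have hq : Nat.card 𝓀[(w.1.adicCompletion L)] = Nat.card (𝓞 ↥(maximalRealSubfield L) ⧸ v.asIdeal) ^ 2 := natCard_residueField_eq_sq_of_inert (IsCMField.complexConj L) v hc1 hunr w hw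
  letI : Fintype 𝓀[(w.1.adicCompletion L)] := Fintype.ofFinite _
  have hq' : Fintype.card 𝓀[(w.1.adicCompletion L)] = Nat.card (𝓞 ↥(maximalRealSubfield L) ⧸ v.asIdeal) ^ 2 := by rw [← Nat.card_eq_fintype_card, hq]
  obtain ⟨a₀, ha₀⟩ := LocalFields.UnramifiedQuadraticNorm.exists_isUnit_map_sub_of_residueHom_ne (galAdicCompletionMap (L := L) (IsCMField.complexConj L) hw) hσO σk hσk
    (Literature.LinearAlgebra.Matrix.exists_frob_ne hq' σk (residueHom_galAdicCompletionMap_eq_pow (IsCMField.complexConj L) v hc1 hunr w hw σk hσO hσk))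
  have ha₀' : IsUnit (σO a₀ - a₀) := ha₀
  exact ncard_selfDualStable_antidiag_companion_eq_sum hϖ (galAdicCompletionMap (L := L) (IsCMField.complexConj L) hw) σO hσO' hσσ hσϖ hσv h2 ht hd he hβ hD htr γ hγ ha₀' hq

end AtPlace

/-! ## §3 The frame at the place `w` and the value -/

section Value

variable (L : Type) [Field L] [NumberField L] [IsCMField L] (v : HeightOneSpectrum (𝓞 ↥(maximalRealSubfield L)))
  (w : PlacesOver L v) (hw : IsCMField.complexConj L • w.1 = w.1)

omit [IsCMField L] in
/-- `(Φ₂)_w = !![0, 1; 1, 0]` (entries `0, 1` under `algebraMap`). [folklore] -/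
private theorem placeForm_antidiagTwo_eq' :
    placeForm (Matrix.of fun i j : Fin 2 => if i.val + j.val + 1 = 2 then (1 : L) else 0) w.1 = (!![0, 1; 1, 0] : Matrix (Fin 2) (Fin 2) (w.1.adicCompletion L)) := by
  ext i j
  fin_cases i <;> fin_cases j <;> simp [placeForm, Matrix.map_apply]

include hw in
/-- **THE COUNT AT THE PLACE `w` FOR A UNITARY MATRIX WITHOUT EIGENVALUES IN `L_w`** (pure `L_w` statement): for `g ∈ GL₂(L_w)` unitary for `(Φ₂)_w = !![0,1;1,0]`,
`χ_g` without root in `L_w`, `tr g ∈ 𝒪`, `|2| = 1`, `|tr² − 4 det| = exp(−(2N+1))`: `#S((Φ₂)_w, g) = Σ_(k ≤ N) q_v^k` — isotropic cyclic frame `P = (e₀ | g e₀)` rescaled by `ϖ^(−r)`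
(`|g₁₀| = |ϖ^(2r+e)|`), ★ (L5-d1) FILE A transport, §1, §2. [cite: Flicker1998UnitaryFL, §6 p. 97] [cite: Rogawski1990, §3.6 p. 31] -/
theorem ncard_selfDualStable_antidiagTwo_eq_sum_of_unitary (hunr : Algebra.IsUnramifiedIn (𝓞 L) v.asIdeal)
    (gGL : GL (Fin 2) (w.1.adicCompletion L)) (g : Matrix (Fin 2) (Fin 2) (w.1.adicCompletion L)) (hcoe : (gGL : Matrix (Fin 2) (Fin 2) (w.1.adicCompletion L)) = g)
    (hgU : (g.map (galAdicCompletionMap (L := L) (IsCMField.complexConj L) hw))ᵀ * (!![0, 1; 1, 0] : Matrix (Fin 2) (Fin 2) (w.1.adicCompletion L)) * g = !![0, 1; 1, 0])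
    (h2v : valuation (w.1.adicCompletion L) 2 = 1) (ht : g.trace ∈ 𝒪[(w.1.adicCompletion L)])
    (hirr : ¬ ∃ x : (w.1.adicCompletion L), (g.charpoly).IsRoot x)
    (N : ℕ) (hN : Valued.v (g.trace ^ 2 - 4 * g.det) = WithZero.exp (-((2 * N + 1 : ℕ) : ℤ))) :
    {Λ : Submodule 𝒪[(w.1.adicCompletion L)] (Fin 2 → (w.1.adicCompletion L)) |
        (∃ g' : GL (Fin 2) (w.1.adicCompletion L), (∃ J' ∈ glInt 2 (w.1.adicCompletion L), (J' : Matrix (Fin 2) (Fin 2) (w.1.adicCompletion L)) =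
            formCongr (galAdicCompletionMap (L := L) (IsCMField.complexConj L) hw) g' (placeForm (Matrix.of fun i j : Fin 2 => if i.val + j.val + 1 = 2 then (1 : L) else 0) w.1)) ∧
          Λ = Submodule.span 𝒪[(w.1.adicCompletion L)] (Set.range ((g' : Matrix (Fin 2) (Fin 2) (w.1.adicCompletion L)))ᵀ)) ∧
        Λ.map ((Matrix.toLin' ((gGL : GL (Fin 2) (w.1.adicCompletion L)) : Matrix (Fin 2) (Fin 2) (w.1.adicCompletion L))).restrictScalars 𝒪[(w.1.adicCompletion L)]) = Λ}.ncard =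
      ∑ k ∈ range (N + 1), Nat.card (𝓞 ↥(maximalRealSubfield L) ⧸ v.asIdeal) ^ k := by
  classical
  have hc1 : IsCMField.complexConj L ≠ 1 := IsCMField.complexConj_ne_one L
  have hϖv := Liu2021.LemD1IndexedNonVacuityInertCofinite.valued_toPlace_uniformizer_of_isUnramifiedIn L v hunr w
  have hϖ : IsUniformizingElement (toPlace v w (GaloisRepresentations.HeckeCharacter.uniformizer ↥(maximalRealSubfield L) v : v.adicCompletion ↥(maximalRealSubfield L))) := isUniformizingElement_of_v_eq hϖv
  have h0 := hϖ.ne_zero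
  haveI : IsDiscreteValuationRing 𝒪[(w.1.adicCompletion L)] := isDiscreteValuationRing_integer_of_compatible hϖv
  have hσv : ∀ x, valuation (w.1.adicCompletion L) ((galAdicCompletionMap (L := L) (IsCMField.complexConj L) hw) x) = valuation (w.1.adicCompletion L) x := fun x => valuation_galAdicCompletionMap_eq (IsCMField.complexConj L) v w hw x
  have hσϖ : (galAdicCompletionMap (L := L) (IsCMField.complexConj L) hw) (toPlace v w (GaloisRepresentations.HeckeCharacter.uniformizer ↥(maximalRealSubfield L) v : v.adicCompletion ↥(maximalRealSubfield L))) = (toPlace v w (GaloisRepresentations.HeckeCharacter.uniformizer ↥(maximalRealSubfield L) v : v.adicCompletion ↥(maximalRealSubfield L))) := galAdicCompletionMap_toPlace (IsCMField.complexConj L) w w hw _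
  -- `g₁₀ ≠ 0` (else `g₀₀` is a root of `χ_g`)
  have hg10 : g 1 0 ≠ 0 := fun h10 => hirr ⟨g 0 0, by
    rw [Polynomial.IsRoot, Matrix.charpoly_fin_two, Matrix.trace_fin_two, Matrix.det_fin_two, h10]
    simp; ring⟩
  -- rescaling exponent: `|g₁₀| = |ϖ^m|`, `m = 2r + e`
  obtain ⟨m, hm⟩ := exists_valuation_eq_valuation_zpow hϖ hg10
  obtain ⟨r, e, he, hme⟩ : ∃ (r : ℤ) (e : ℕ), e ≤ 1 ∧ m = 2 * r + e := ⟨m / 2, (m % 2).toNat, by omega, by omega⟩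
  obtain ⟨a, ha⟩ : ∃ a : (w.1.adicCompletion L), (toPlace v w (GaloisRepresentations.HeckeCharacter.uniformizer ↥(maximalRealSubfield L) v : v.adicCompletion ↥(maximalRealSubfield L))) ^ (-r) = a := ⟨_, rfl⟩
  have ha0 : a ≠ 0 := by rw [← ha]; exact zpow_ne_zero _ h0
  have hσa : (galAdicCompletionMap (L := L) (IsCMField.complexConj L) hw) a = a := by rw [← ha, map_zpow₀, hσϖ]
  -- the rescaled isotropic cyclic frame (§1)
  obtain ⟨P', hC', hform', hdβ, htr⟩ := exists_rescaled_cyclicFrame (galAdicCompletionMap (L := L) (IsCMField.complexConj L) hw) gGL g hcoe hgU hg10 ha0 hσa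
  -- valuations
  have hdv : valuation (w.1.adicCompletion L) g.det = 1 := by
    have h := congrArg (valuation (w.1.adicCompletion L)) hdβ
    rw [map_mul, Valuation.map_neg, hσv] at h
    exact mul_right_cancel₀ ((Valuation.ne_zero_iff _).2 hg10) (h.trans (one_mul _).symm)
  have hD : valuation (w.1.adicCompletion L) (g.trace ^ 2 - 4 * g.det) = valuation (w.1.adicCompletion L) ((toPlace v w (GaloisRepresentations.HeckeCharacter.uniformizer ↥(maximalRealSubfield L) v : v.adicCompletion ↥(maximalRealSubfield L))) ^ (2 * N + 1)) := by
    refine (v_eq_iff_valuation_eq _ _).1 ?_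
    rw [hN, map_pow, hϖv, ← WithZero.exp_nsmul]
    simp
  have hβ' : valuation (w.1.adicCompletion L) (a ^ 2 * g 1 0) = valuation (w.1.adicCompletion L) ((toPlace v w (GaloisRepresentations.HeckeCharacter.uniformizer ↥(maximalRealSubfield L) v : v.adicCompletion ↥(maximalRealSubfield L))) ^ e) := by
    rw [map_mul, hm, ← map_mul, ← ha, ← zpow_natCast ((toPlace v w (GaloisRepresentations.HeckeCharacter.uniformizer ↥(maximalRealSubfield L) v : v.adicCompletion ↥(maximalRealSubfield L))) ^ (-r)), ← _root_.zpow_mul, ← zpow_add₀ h0, ← zpow_natCast]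
    congr 2; push_cast; omega
  have htr' : a ^ 2 * g 1 0 * (galAdicCompletionMap (L := L) (IsCMField.complexConj L) hw) g.trace + (galAdicCompletionMap (L := L) (IsCMField.complexConj L) hw) (a ^ 2 * g 1 0) * g.trace = 0 := by
    rw [map_mul, map_pow, hσa]
    linear_combination a ^ 2 * htr
  -- transport (★ (L5-d1) FILE A) and count (§2)
  rw [ncard_selfDualStable_congr (galAdicCompletionMap (L := L) (IsCMField.complexConj L) hw) (placeForm (Matrix.of fun i j : Fin 2 => if i.val + j.val + 1 = 2 then (1 : L) else 0) w.1) gGL P', placeForm_antidiagTwo_eq' L v w, hform']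
  exact ncard_selfDualStable_antidiag_companion_eq_sum_at L v w hw hunr h2v ht hdv he hβ' hD htr' _ hC'

set_option maxHeartbeats 400000 in
include hw in
/-- **THE COUNT AT THE PLACE `w` FOR A TYPE-(2) ELEMENT** `γ₂ ∈ U(Φ₂)(L⁺_v)` in the stub frame (`hint`, `h2`, `hirr` at `w`, `hN`): `#S((Φ₂)_w, (γ₂)_w) = Σ_(k ≤ N) q_v^k`.
[cite: Flicker1998UnitaryFL, §6 p. 97] [cite: Rogawski1990, §3.6 p. 31] -/
theorem ncard_selfDualStable_antidiagTwo_eq_sum_of_not_exists_isRoot (hunr : Algebra.IsUnramifiedIn (𝓞 L) v.asIdeal)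
    (γH : (cmDatum L 2 (Matrix.of fun i j : Fin 2 => if i.val + j.val + 1 = 2 then (1 : L) else 0)).Local v × (cmDatum L 1 (Matrix.of fun i j : Fin 1 => if i.val + j.val + 1 = 1 then (1 : L) else 0)).Local v) (h2 : IsUnit (2 : 𝒪[(w.1.adicCompletion L)]))
    (hint : ∀ i : ℕ, ((((endoEmbLocal L v γH).val : GL (Fin 3) (LocalRing L v)).val.map (Pi.evalRingHom (fun w' : PlacesOver L v => w'.1.adicCompletion L) w)).charpoly.coeff i) ∈ 𝒪[(w.1.adicCompletion L)])
    (hirr : ¬ ∃ x : (w.1.adicCompletion L), (((((γH.1.val : GL (Fin 2) (LocalRing L v)) : Matrix (Fin 2) (Fin 2) (LocalRing L v)).map (Pi.evalRingHom (fun w' : PlacesOver L v => w'.1.adicCompletion L) w))).charpoly).IsRoot x)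
    (N : ℕ) (hN : Valued.v (((((γH.1.val : GL (Fin 2) (LocalRing L v)) : Matrix (Fin 2) (Fin 2) (LocalRing L v)).map (Pi.evalRingHom (fun w' : PlacesOver L v => w'.1.adicCompletion L) w))).trace ^ 2 - 4 * ((((γH.1.val : GL (Fin 2) (LocalRing L v)) : Matrix (Fin 2) (Fin 2) (LocalRing L v)).map (Pi.evalRingHom (fun w' : PlacesOver L v => w'.1.adicCompletion L) w))).det) = WithZero.exp (-((2 * N + 1 : ℕ) : ℤ))) :
    {Λ : Submodule 𝒪[(w.1.adicCompletion L)] (Fin 2 → (w.1.adicCompletion L)) |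
        (∃ g : GL (Fin 2) (w.1.adicCompletion L), (∃ J' ∈ glInt 2 (w.1.adicCompletion L), (J' : Matrix (Fin 2) (Fin 2) (w.1.adicCompletion L)) =
            formCongr (galAdicCompletionMap (L := L) (IsCMField.complexConj L) hw) g (placeForm (Matrix.of fun i j : Fin 2 => if i.val + j.val + 1 = 2 then (1 : L) else 0) w.1)) ∧
          Λ = Submodule.span 𝒪[(w.1.adicCompletion L)] (Set.range ((g : Matrix (Fin 2) (Fin 2) (w.1.adicCompletion L)))ᵀ)) ∧
        Λ.map ((Matrix.toLin' ((((localNonsplitEquiv (IsCMField.complexConj L) (Matrix.of fun i j : Fin 2 => if i.val + j.val + 1 = 2 then (1 : L) else 0) (IsCMField.complexConj_ne_one L) w hw γH.1 : unitaryGroupOfForm (galAdicCompletionMap (L := L) (IsCMField.complexConj L) hw) (placeForm (Matrix.of fun i j : Fin 2 => if i.val + j.val + 1 = 2 then (1 : L) else 0) w.1)) : GL (Fin 2) (w.1.adicCompletion L))) : Matrix (Fin 2) (Fin 2) (w.1.adicCompletion L))).restrictScalars 𝒪[(w.1.adicCompletion L)]) = Λ}.ncard =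
      ∑ k ∈ range (N + 1), Nat.card (𝓞 ↥(maximalRealSubfield L) ⧸ v.asIdeal) ^ k := by
  have hcoe : ((((localNonsplitEquiv (IsCMField.complexConj L) (Matrix.of fun i j : Fin 2 => if i.val + j.val + 1 = 2 then (1 : L) else 0) (IsCMField.complexConj_ne_one L) w hw γH.1 : unitaryGroupOfForm (galAdicCompletionMap (L := L) (IsCMField.complexConj L) hw) (placeForm (Matrix.of fun i j : Fin 2 => if i.val + j.val + 1 = 2 then (1 : L) else 0) w.1)) : GL (Fin 2) (w.1.adicCompletion L))) : Matrix (Fin 2) (Fin 2) (w.1.adicCompletion L)) = (((γH.1.val : GL (Fin 2) (LocalRing L v)) : Matrix (Fin 2) (Fin 2) (LocalRing L v)).map (Pi.evalRingHom (fun w' : PlacesOver L v => w'.1.adicCompletion L) w)) :=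
    coe_localNonsplitEquiv_apply L (Matrix.of fun i j : Fin 2 => if i.val + j.val + 1 = 2 then (1 : L) else 0) v w hw γH.1
  have hgU : (((((γH.1.val : GL (Fin 2) (LocalRing L v)) : Matrix (Fin 2) (Fin 2) (LocalRing L v)).map (Pi.evalRingHom (fun w' : PlacesOver L v => w'.1.adicCompletion L) w))).map (galAdicCompletionMap (L := L) (IsCMField.complexConj L) hw))ᵀ * (!![0, 1; 1, 0] : Matrix (Fin 2) (Fin 2) (w.1.adicCompletion L)) * (((γH.1.val : GL (Fin 2) (LocalRing L v)) : Matrix (Fin 2) (Fin 2) (LocalRing L v)).map (Pi.evalRingHom (fun w' : PlacesOver L v => w'.1.adicCompletion L) w)) = !![0, 1; 1, 0] := by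
    rw [← hcoe, ← placeForm_antidiagTwo_eq' L v w]
    exact (mem_unitaryGroupOfForm_iff (σ := (galAdicCompletionMap (L := L) (IsCMField.complexConj L) hw)) (J := placeForm (Matrix.of fun i j : Fin 2 => if i.val + j.val + 1 = 2 then (1 : L) else 0) w.1) (g := ((localNonsplitEquiv (IsCMField.complexConj L) (Matrix.of fun i j : Fin 2 => if i.val + j.val + 1 = 2 then (1 : L) else 0) (IsCMField.complexConj_ne_one L) w hw γH.1 : unitaryGroupOfForm (galAdicCompletionMap (L := L) (IsCMField.complexConj L) hw) (placeForm (Matrix.of fun i j : Fin 2 => if i.val + j.val + 1 = 2 then (1 : L) else 0) w.1)) : GL (Fin 2) (w.1.adicCompletion L)))).1 ((localNonsplitEquiv (IsCMField.complexConj L) (Matrix.of fun i j : Fin 2 => if i.val + j.val + 1 = 2 then (1 : L) else 0) (IsCMField.complexConj_ne_one L) w hw γH.1 : unitaryGroupOfForm (galAdicCompletionMap (L := L) (IsCMField.complexConj L) hw) (placeForm (Matrix.of fun i j : Fin 2 => if i.val + j.val + 1 = 2 then (1 : L) else 0) w.1))).2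
  obtain ⟨htv, -⟩ := valued_trace_le_one_and_valued_det_le_one_of_hint L v w hw (a := γH)
    (fun i => by rw [valuedInteger_eq_integer]; exact hint i)
  have ht : ((((γH.1.val : GL (Fin 2) (LocalRing L v)) : Matrix (Fin 2) (Fin 2) (LocalRing L v)).map (Pi.evalRingHom (fun w' : PlacesOver L v => w'.1.adicCompletion L) w))).trace ∈ 𝒪[(w.1.adicCompletion L)] := (v_le_one_iff_mem_integer _).1 htv
  have h2v : valuation (w.1.adicCompletion L) 2 = 1 := by
    have := (Valuation.integer.integers (valuation (w.1.adicCompletion L))).isUnit_iff_valuation_eq_one.1 h2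
    rwa [map_ofNat] at this
  exact ncard_selfDualStable_antidiagTwo_eq_sum_of_unitary L v w hw hunr _ _ hcoe hgU h2v ht hirr N hN

end Value

/-! ## §4 The value stub: `Φ(⟦γ_H⟧, 1_{K_H}) = phiHtwo q N` -/

section Head

variable (L : Type) [Field L] [NumberField L] [IsCMField L] (v : HeightOneSpectrum (𝓞 ↥(maximalRealSubfield L)))
  (w : PlacesOver L v) (hw : IsCMField.complexConj L • w.1 = w.1)
  [MeasurableSpace ((cmDatum L 2 (Matrix.of fun i j : Fin 2 => if i.val + j.val + 1 = 2 then (1 : L) else 0)).Local v × (cmDatum L 1 (Matrix.of fun i j : Fin 1 => if i.val + j.val + 1 = 1 then (1 : L) else 0)).Local v)] [BorelSpace ((cmDatum L 2 (Matrix.of fun i j : Fin 2 => if i.val + j.val + 1 = 2 then (1 : L) else 0)).Local v × (cmDatum L 1 (Matrix.of fun i j : Fin 1 => if i.val + j.val + 1 = 1 then (1 : L) else 0)).Local v)]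
  [∀ a : (cmDatum L 2 (Matrix.of fun i j : Fin 2 => if i.val + j.val + 1 = 2 then (1 : L) else 0)).Local v × (cmDatum L 1 (Matrix.of fun i j : Fin 1 => if i.val + j.val + 1 = 1 then (1 : L) else 0)).Local v, MeasurableSpace (((cmDatum L 2 (Matrix.of fun i j : Fin 2 => if i.val + j.val + 1 = 2 then (1 : L) else 0)).Local v × (cmDatum L 1 (Matrix.of fun i j : Fin 1 => if i.val + j.val + 1 = 1 then (1 : L) else 0)).Local v) ⧸ Subgroup.centralizer ({a} : Set ((cmDatum L 2 (Matrix.of fun i j : Fin 2 => if i.val + j.val + 1 = 2 then (1 : L) else 0)).Local v × (cmDatum L 1 (Matrix.of fun i j : Fin 1 => if i.val + j.val + 1 = 1 then (1 : L) else 0)).Local v)))]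
  [∀ a : (cmDatum L 2 (Matrix.of fun i j : Fin 2 => if i.val + j.val + 1 = 2 then (1 : L) else 0)).Local v × (cmDatum L 1 (Matrix.of fun i j : Fin 1 => if i.val + j.val + 1 = 1 then (1 : L) else 0)).Local v, BorelSpace (((cmDatum L 2 (Matrix.of fun i j : Fin 2 => if i.val + j.val + 1 = 2 then (1 : L) else 0)).Local v × (cmDatum L 1 (Matrix.of fun i j : Fin 1 => if i.val + j.val + 1 = 1 then (1 : L) else 0)).Local v) ⧸ Subgroup.centralizer ({a} : Set ((cmDatum L 2 (Matrix.of fun i j : Fin 2 => if i.val + j.val + 1 = 2 then (1 : L) else 0)).Local v × (cmDatum L 1 (Matrix.of fun i j : Fin 1 => if i.val + j.val + 1 = 1 then (1 : L) else 0)).Local v)))]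
  (νH : Measure ((cmDatum L 2 (Matrix.of fun i j : Fin 2 => if i.val + j.val + 1 = 2 then (1 : L) else 0)).Local v × (cmDatum L 1 (Matrix.of fun i j : Fin 1 => if i.val + j.val + 1 = 1 then (1 : L) else 0)).Local v)) [νH.IsHaarMeasure] [νH.IsMulRightInvariant]

omit [IsCMField L] in
/-- `2 ≤ q_v`. [cite: NeukirchANT1999, Ch. I §3] -/
private theorem two_le_natCard_quotient' : 2 ≤ Nat.card (𝓞 ↥(maximalRealSubfield L) ⧸ v.asIdeal) := by
  classical
  haveI : Finite (𝓞 ↥(maximalRealSubfield L) ⧸ v.asIdeal) := Ideal.finiteQuotientOfFreeOfNeBot v.asIdeal v.ne_bot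
  haveI : Nontrivial (𝓞 ↥(maximalRealSubfield L) ⧸ v.asIdeal) := Ideal.Quotient.nontrivial_iff.2 v.isPrime.ne_top
  exact Finite.one_lt_card

include hw in
/-- **THE TYPE-(2) H-SIDE VALUE — payer of `stub_irredHValue (N hN)` («N7nsCount» ED. 1.3) modulo `[CompactSpace Z(γ₂)]`.**  At a finite place `v` non-split and
unramified in `L`, `m_H` canonical for `(IsLocalGRegular, ν_H)`, `ν_H(K₂ ×ˢ K₁) = 1`; for `γ_H = (γ₂, γ₁)` `G`-regular with `χ_{ι(γ_H),w}` integral (`hint`), `2 ∈ 𝒪_w^×`,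
`χ_{γ₂,w}` WITHOUT ROOT in `L_w` (type (2)), and `|tr(γ₂)_w² − 4 det(γ₂)_w| = exp(−(2N+1))`, the centraliser of `γ₂` being compact:
`Φ(⟦γ_H⟧, 1_{K₂ ×ˢ K₁}) = phiHtwo q_v N = (q_v^(N+1) − 1)∕(q_v − 1)` (★ PAIR p840404 ∘ ★ lattice socket ∘ §3 ∘ `geom_sum_eq`).
[cite: Flicker1998UnitaryFL, §6 p. 97] [cite: Rogawski1990, §4.9 Prop. 4.9.1 (b) p. 55] -/
theorem classOrbitalIntegral_indicator_eq_phiHtwo_of_not_exists_isRoot (hunr : Algebra.IsUnramifiedIn (𝓞 L) v.asIdeal)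
    {mH : OrbitalMeasureFamily ((cmDatum L 2 (Matrix.of fun i j : Fin 2 => if i.val + j.val + 1 = 2 then (1 : L) else 0)).Local v × (cmDatum L 1 (Matrix.of fun i j : Fin 1 => if i.val + j.val + 1 = 1 then (1 : L) else 0)).Local v)} (hmH : mH.IsCanonical (IsLocalGRegular L v) νH)
    (hνH : νH ((((cmLocalIntegralLevel L 2 (Matrix.of fun i j : Fin 2 => if i.val + j.val + 1 = 2 then (1 : L) else 0) v).prod (cmLocalIntegralLevel L 1 (Matrix.of fun i j : Fin 1 => if i.val + j.val + 1 = 1 then (1 : L) else 0) v)) : Subgroup ((cmDatum L 2 (Matrix.of fun i j : Fin 2 => if i.val + j.val + 1 = 2 then (1 : L) else 0)).Local v × (cmDatum L 1 (Matrix.of fun i j : Fin 1 => if i.val + j.val + 1 = 1 then (1 : L) else 0)).Local v)) : Set ((cmDatum L 2 (Matrix.of fun i j : Fin 2 => if i.val + j.val + 1 = 2 then (1 : L) else 0)).Local v × (cmDatum L 1 (Matrix.of fun i j : Fin 1 => if i.val + j.val + 1 = 1 then (1 : L) else 0)).Local v)) = 1)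
    {γH : (cmDatum L 2 (Matrix.of fun i j : Fin 2 => if i.val + j.val + 1 = 2 then (1 : L) else 0)).Local v × (cmDatum L 1 (Matrix.of fun i j : Fin 1 => if i.val + j.val + 1 = 1 then (1 : L) else 0)).Local v} (hreg : IsLocalGRegular L v γH)
    [CompactSpace (Subgroup.centralizer ({γH.1} : Set ((cmDatum L 2 (Matrix.of fun i j : Fin 2 => if i.val + j.val + 1 = 2 then (1 : L) else 0)).Local v)))]
    (h2 : IsUnit (2 : 𝒪[(w.1.adicCompletion L)]))
    (hint : ∀ i : ℕ, ((((endoEmbLocal L v γH).val : GL (Fin 3) (LocalRing L v)).val.map (Pi.evalRingHom (fun w' : PlacesOver L v => w'.1.adicCompletion L) w)).charpoly.coeff i) ∈ 𝒪[(w.1.adicCompletion L)])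
    (hirr : ¬ ∃ x : (w.1.adicCompletion L), (((((γH.1.val : GL (Fin 2) (LocalRing L v)) : Matrix (Fin 2) (Fin 2) (LocalRing L v)).map (Pi.evalRingHom (fun w' : PlacesOver L v => w'.1.adicCompletion L) w))).charpoly).IsRoot x)
    (N : ℕ) (hN : Valued.v (((((γH.1.val : GL (Fin 2) (LocalRing L v)) : Matrix (Fin 2) (Fin 2) (LocalRing L v)).map (Pi.evalRingHom (fun w' : PlacesOver L v => w'.1.adicCompletion L) w))).trace ^ 2 - 4 * ((((γH.1.val : GL (Fin 2) (LocalRing L v)) : Matrix (Fin 2) (Fin 2) (LocalRing L v)).map (Pi.evalRingHom (fun w' : PlacesOver L v => w'.1.adicCompletion L) w))).det) = WithZero.exp (-((2 * N + 1 : ℕ) : ℤ))) :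
    classOrbitalIntegral mH (((((cmLocalIntegralLevel L 2 (Matrix.of fun i j : Fin 2 => if i.val + j.val + 1 = 2 then (1 : L) else 0) v).prod (cmLocalIntegralLevel L 1 (Matrix.of fun i j : Fin 1 => if i.val + j.val + 1 = 1 then (1 : L) else 0) v)) : Subgroup ((cmDatum L 2 (Matrix.of fun i j : Fin 2 => if i.val + j.val + 1 = 2 then (1 : L) else 0)).Local v × (cmDatum L 1 (Matrix.of fun i j : Fin 1 => if i.val + j.val + 1 = 1 then (1 : L) else 0)).Local v)) : Set ((cmDatum L 2 (Matrix.of fun i j : Fin 2 => if i.val + j.val + 1 = 2 then (1 : L) else 0)).Local v × (cmDatum L 1 (Matrix.of fun i j : Fin 1 => if i.val + j.val + 1 = 1 then (1 : L) else 0)).Local v)).indicator fun _ => (1 : ℂ)) (ConjClasses.mk γH) = ((Flicker1998.phiHtwo (Ideal.absNorm v.asIdeal) N : ℚ) : ℂ) := by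
  have hcount := ncard_selfDualStable_antidiagTwo_eq_sum_of_not_exists_isRoot L v w hw hunr γH h2 hint hirr N hN
  have hq2 := two_le_natCard_quotient' L v
  refine (classOrbitalIntegral_indicator_complex_cmLocalIntegralLevel_prod_eq_natCard_fixedBy_fst L v νH hmH hνH γH hreg w hw).trans ?_
  rw [natCard_fixedBy_eq_ncard_selfDualStable_antidiagTwo L v w hw hunr γH.1, hcount, Flicker1998.phiHtwo, Ideal.absNorm_apply, Submodule.cardQuot_apply]
  have hq1 : ((Nat.card (𝓞 ↥(maximalRealSubfield L) ⧸ v.asIdeal) : ℚ)) ≠ 1 := by exact_mod_cast (show Nat.card (𝓞 ↥(maximalRealSubfield L) ⧸ v.asIdeal) ≠ 1 by omega)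
  rw [← geom_sum_eq hq1 (N + 1)]
  push_cast
  rfl

end Head

end Literature.NumberTheory.Automorphic.UnitaryGroup

end
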